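import Summits.Parity.BatemanHorn.Theorems.AlmostPrimeZerosSystemLSDRealSegmentNairClassesSmall
import Summits.Parity.BatemanHorn.Theorems.AlmostPrimeZerosSystemLSDRealSegmentNairClassFour
import HarnessLib

/-!
# Nair–Tenenbaum light, X: the theorem `nair_sum_le`

Crux `SystemLSDRealSegment` (stmt-Parity-11292, route `AlmostPrimeZeros`), line `beta-thinned-root-kernel`,
support programme of the lead c8: **Nair–Tenenbaum "light"** — the sharp-order upper bound
`Σ_{1≤n≤N} G(F(n)) ≤ C · N · exp(Σ_{p≤N} (G(p) − 1) ρ_F(p)/p)` for a polynomial `F ∈ ℤ[X]` (degree `≥ 1`, positive on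
`ℕ_{≥1}`, root counts `ρ_F(p) ≤ D`, `ρ_F(p) < p`, `ρ_F(p^a) ≤ M`) and every weight `G ≥ 0`, `G(1) = 1`, multiplicative on
coprime arguments with `G(p^v) ≤ A` (M. Nair, Acta Arith. 62 (1992); Nair–Tenenbaum, Acta Math. 180 (1998), Thm 1 —
the special case of the class bounded at prime powers), by Shiu's method (J. reine angew. Math. 313 (1980), §5) run on the
values `m = F(n)`: cut `m = c·d` at `√N` (`Shiu.cutPrime/cPart/dPart`), four classes, the beta upper-bound sieve of dimension
`2D` on the root classes of `c`, Hall–Tenenbaum's Theorem 01 and Rankin's trick with a uniform exponent for the `c`-sums.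
Applied (file `…NairUpperBound`) to the product polynomial of a Bateman–Horn system with `G = y^{capped}` it gives
`Σ_{n≤x} y^{s_f(n)} ≪ x (log x)^{k(y−1)}`, i.e. `H_x(y) = O(1)` on the real segment — the upper half of the order of
magnitude predicted by the crux (lower half: `sumPowStat_lower_bound`, landed).  Everything here is PROVED; no definitions.

This file: assembly of the five classes: `Σ_{1≤n≤N} G(F(n)) ≤ C N exp(Σ_{p≤N} (G(p)−1)ρ_F(p)/p)` for all `N ≥ 2`, uniformly over the weight class.
-/

open Finset Real Polynomial

namespace Summit.Parity.BatemanHorn.Cruxes.SystemLSDRealSegment.BetaThinnedRootKernel.Nair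

open Literature.NumberTheory.Sieve

noncomputable section

section Main

variable {F : ℤ[X]} {D M : ℕ} {A : ℝ}

/-- Power savings are absorbed by the main term: `N^{23/24} ≤ K · N · exp(Σ_{p≤N} (G(p)−1)ρ(p)/p)` for `N ≥ 2`,
`G ≥ 0`, with `K = e^{4D} exp(D log(24D+1))`. [folklore] -/
theorem rpow_le_mul_exp_sum {G : ℕ → ℝ} (hG0 : ∀ n, 0 ≤ G n)
    (hD : ∀ p : ℕ, p.Prime → polyRootCountMod ![F] p ≤ D) {N : ℕ} (hN : 2 ≤ N) :
    (N : ℝ) ^ (23 / 24 : ℝ) ≤ Real.exp (4 * D) * Real.exp (D * Real.log (D / (1 / 24) + 1)) * N *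
      Real.exp (∑ p ∈ Nat.primesLE N, (G p - 1) * polyRootCountMod ![F] p / p) := by
  have hN1 : (1 : ℝ) < N := by exact_mod_cast (show 1 < N by omega)
  have hN0 : (0 : ℝ) < N := by linarith
  have hD0 : (0 : ℝ) ≤ D := Nat.cast_nonneg _
  set ℓ := Real.log (Real.log N) with hℓ
  have hlow := exp_neg_le_exp_sum (F := F) hG0 hD hN
  have hll := exp_mul_loglog_le hN1 hD0 (show (0 : ℝ) < 1 / 24 by norm_num)
  have h1 : (N : ℝ) ^ (23 / 24 : ℝ) = (N : ℝ) ^ (23 / 24 : ℝ) * Real.exp (D * ℓ) * Real.exp (-(D * ℓ)) := by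
    rw [mul_assoc, ← Real.exp_add, add_neg_cancel, Real.exp_zero, mul_one]
  have h2 : Real.exp (-(D * ℓ)) = Real.exp (4 * D) * Real.exp (-(D * (ℓ + 4))) := by
    rw [← Real.exp_add]; ring_nf
  calc (N : ℝ) ^ (23 / 24 : ℝ) = (N : ℝ) ^ (23 / 24 : ℝ) * Real.exp (D * ℓ) * Real.exp (-(D * ℓ)) := h1
    _ ≤ (N : ℝ) ^ (23 / 24 : ℝ) * (Real.exp (D * Real.log (D / (1 / 24) + 1)) * (N : ℝ) ^ (1 / 24 : ℝ)) *
        Real.exp (-(D * ℓ)) := by gcongr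
    _ = Real.exp (D * Real.log (D / (1 / 24) + 1)) * ((N : ℝ) ^ (23 / 24 : ℝ) * (N : ℝ) ^ (1 / 24 : ℝ)) *
        (Real.exp (4 * D) * Real.exp (-(D * (ℓ + 4)))) := by rw [h2]; ring
    _ = Real.exp (4 * D) * Real.exp (D * Real.log (D / (1 / 24) + 1)) * N * Real.exp (-(D * (ℓ + 4))) := by
        rw [← Real.rpow_add hN0]; norm_num; ring
    _ ≤ _ := by gcongr

/-- **Nair's theorem, bounded-prime-power class** (Nair 1992; Nair–Tenenbaum 1998, Thm 1, special case): for
`F ∈ ℤ[X]` of degree `≥ 1`, positive on `ℕ_{≥1}`, with `ρ(p) ≤ D`, `ρ(p) < p`, `ρ(p^a) ≤ M`, and `A ≥ 1`, there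
is `C` such that for every weight `G ≥ 0` with `G(1) = 1`, multiplicative on coprime arguments and `G(p^v) ≤ A`,
and every `N ≥ 2`: `Σ_{1≤n≤N} G(F(n)) ≤ C N exp(Σ_{p≤N} (G(p) − 1)ρ(p)/p)`.
[cite: NairTenenbaum1998, Theorem 1] -/
theorem nair_sum_le (hd : 1 ≤ F.natDegree) (hpos : ∀ n : ℕ, 1 ≤ n → 0 < F.eval (n : ℤ))
    (hD : ∀ p : ℕ, p.Prime → polyRootCountMod ![F] p ≤ D) (hD1 : 1 ≤ D)
    (hfix : ∀ p : ℕ, p.Prime → polyRootCountMod ![F] p < p)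
    (hM : ∀ p : ℕ, p.Prime → ∀ a : ℕ, 1 ≤ a → polyRootCountMod ![F] (p ^ a) ≤ M) (hM1 : 1 ≤ M) (hA : 1 ≤ A) :
    ∃ C : ℝ, 0 < C ∧ ∀ G : ℕ → ℝ, (∀ n, 0 ≤ G n) → G 1 = 1 →
      (∀ m n : ℕ, m.Coprime n → G (m * n) = G m * G n) →
      (∀ p : ℕ, p.Prime → ∀ v : ℕ, 1 ≤ v → G (p ^ v) ≤ A) →
      ∀ N : ℕ, 2 ≤ N →
        ∑ n ∈ Icc 1 N, G (F.eval (n : ℤ)).toNat ≤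
          C * N * Real.exp (∑ p ∈ Nat.primesLE N, (G p - 1) * polyRootCountMod ![F] p / p) := by
  obtain ⟨C₀, hC₀, h0⟩ := class0_le (F := F) hd hA
  obtain ⟨C₂, hC₂, h2⟩ := class2_le hd hpos hD1 hM hM1 hA
  obtain ⟨L, hL, C₄, hC₄, N₄, h4⟩ := class4_le hd hpos hD hD1 hfix hM hM1 hA
  obtain ⟨C₃, hC₃, h3⟩ := class3_le hd hpos hM hM1 hA hL
  obtain ⟨C₁, hC₁, N₁, h1⟩ := class1_le hd hpos hD hD1 hfix hM hM1 hA
  obtain ⟨Cg, hCg, hW⟩ := weight_global_le hd hA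
  set N₀ : ℕ := max 2 (max N₁ N₄) with hN₀
  set Kp : ℝ := Real.exp (4 * D) * Real.exp (D * Real.log (D / (1 / 24) + 1)) with hKp
  have hKp0 : 0 < Kp := by positivity
  refine ⟨(C₀ + C₂ + C₃ + Cg * (N₀ : ℝ) ^ (1 / 12 : ℝ)) * Kp + C₁ + C₄, by positivity, ?_⟩
  intro G hG0 hG1 hGmul hGA N hN
  have hN1 : (1 : ℝ) ≤ N := by exact_mod_cast (show 1 ≤ N by omega)
  have hN0 : (0 : ℝ) < N := by linarith
  set E : ℝ := Real.exp (∑ p ∈ Nat.primesLE N, (G p - 1) * polyRootCountMod ![F] p / p) with hE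
  have hKpow : (N : ℝ) ^ (23 / 24 : ℝ) ≤ Kp * N * E := rpow_le_mul_exp_sum hG0 hD hN
  have hE0 : 0 < E := Real.exp_pos _
  -- monotonicity of the power savings
  have h34 : (N : ℝ) ^ (3 / 4 : ℝ) ≤ (N : ℝ) ^ (23 / 24 : ℝ) := Real.rpow_le_rpow_of_exponent_le hN1 (by norm_num)
  have h56 : (N : ℝ) ^ (5 / 6 : ℝ) ≤ (N : ℝ) ^ (23 / 24 : ℝ) := Real.rpow_le_rpow_of_exponent_le hN1 (by norm_num)
  by_cases hNN : N₀ ≤ N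
  · -- large `N`: the five classes
    have hN₁ : N₁ ≤ N := le_trans ((le_max_left _ _).trans (le_max_right _ _)) hNN
    have hN₄ : N₄ ≤ N := le_trans ((le_max_right _ _).trans (le_max_right _ _)) hNN
    set T := Icc 1 N with hT
    set z₀ : ℝ := (N : ℝ) ^ (1 / (4 * (18 * (D : ℝ) + 1))) with hz₀
    set Y : ℝ := (N : ℝ) ^ (1 / 4 : ℝ) with hY
    set mf : ℕ → ℕ := fun n => (F.eval (n : ℤ)).toNat with hmf
    set Pf : ℕ → ℝ := fun n => (Shiu.cutPrime (Real.sqrt N) (mf n) : ℝ) with hPf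
    set cfr : ℕ → ℝ := fun n => (Shiu.cPart (Real.sqrt N) (mf n) : ℝ) with hcfr
    have hf0 : ∀ n ∈ T, 0 ≤ G (mf n) := fun n _ => hG0 _
    -- the five class sums
    have hS0 := h0 G hG0 hG1 hGmul hGA N (by omega)
    have hS1 := h1 G hG0 hG1 hGmul hGA N hN₁
    have hS2 := h2 G hG0 hG1 hGmul hGA N hN
    have hS3 := h3 G hG0 hG1 hGmul hGA N hN
    have hS4 := h4 G hG0 hG1 hGmul hGA N hN₄
    -- splitting
    have hsplit : ∑ n ∈ T, G (mf n) =
        ∑ n ∈ T.filter (fun n => (mf n : ℝ) ≤ Real.sqrt N), G (mf n) +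
        (∑ n ∈ (T.filter (fun n => ¬ (mf n : ℝ) ≤ Real.sqrt N)).filter (fun n => z₀ ≤ Pf n), G (mf n) +
        (∑ n ∈ ((T.filter (fun n => ¬ (mf n : ℝ) ≤ Real.sqrt N)).filter (fun n => ¬ z₀ ≤ Pf n)).filter
            (fun n => cfr n ≤ Y), G (mf n) +
        (∑ n ∈ (((T.filter (fun n => ¬ (mf n : ℝ) ≤ Real.sqrt N)).filter (fun n => ¬ z₀ ≤ Pf n)).filter
            (fun n => ¬ cfr n ≤ Y)).filter (fun n => Pf n ≤ L), G (mf n) +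
        ∑ n ∈ (((T.filter (fun n => ¬ (mf n : ℝ) ≤ Real.sqrt N)).filter (fun n => ¬ z₀ ≤ Pf n)).filter
            (fun n => ¬ cfr n ≤ Y)).filter (fun n => ¬ Pf n ≤ L), G (mf n)))) := by
      rw [Finset.sum_filter_add_sum_filter_not, Finset.sum_filter_add_sum_filter_not,
        Finset.sum_filter_add_sum_filter_not, Finset.sum_filter_add_sum_filter_not]
    rw [hsplit]
    -- compare each piece with the class sums
    have hmem : ∀ {n : ℕ}, n ∈ T → 1 ≤ n ∧ n ≤ N := fun hn => Finset.mem_Icc.1 hn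
    have hp0 : ∑ n ∈ T.filter (fun n => (mf n : ℝ) ≤ Real.sqrt N), G (mf n) ≤ C₀ * (N : ℝ) ^ (3 / 4 : ℝ) := by
      refine le_trans (Finset.sum_le_sum_of_subset_of_nonneg ?_ fun n _ _ => hG0 _) hS0
      intro n hn
      simp only [Finset.mem_filter] at hn ⊢
      exact ⟨hn.1, hpos n (hmem hn.1).1, hn.2⟩
    have hp1 : ∑ n ∈ (T.filter (fun n => ¬ (mf n : ℝ) ≤ Real.sqrt N)).filter (fun n => z₀ ≤ Pf n), G (mf n) ≤
        C₁ * N * E := by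
      refine le_trans (Finset.sum_le_sum_of_subset_of_nonneg ?_ fun n _ _ => hG0 _) hS1
      intro n hn
      simp only [Finset.mem_filter, not_le] at hn ⊢
      exact ⟨hn.1.1, hn.1.2, hn.2⟩
    have hp2 : ∑ n ∈ ((T.filter (fun n => ¬ (mf n : ℝ) ≤ Real.sqrt N)).filter (fun n => ¬ z₀ ≤ Pf n)).filter
        (fun n => cfr n ≤ Y), G (mf n) ≤ C₂ * (N : ℝ) ^ (5 / 6 : ℝ) := by
      refine le_trans (Finset.sum_le_sum_of_subset_of_nonneg ?_ fun n _ _ => hG0 _) hS2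
      intro n hn
      simp only [Finset.mem_filter, not_le] at hn ⊢
      exact ⟨hn.1.1.1, hn.1.1.2, hn.1.2, hn.2⟩
    have hp3 : ∑ n ∈ (((T.filter (fun n => ¬ (mf n : ℝ) ≤ Real.sqrt N)).filter (fun n => ¬ z₀ ≤ Pf n)).filter
        (fun n => ¬ cfr n ≤ Y)).filter (fun n => Pf n ≤ L), G (mf n) ≤ C₃ * (N : ℝ) ^ (23 / 24 : ℝ) := by
      refine le_trans (Finset.sum_le_sum_of_subset_of_nonneg ?_ fun n _ _ => hG0 _) hS3
      intro n hn
      simp only [Finset.mem_filter, not_le] at hn ⊢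
      exact ⟨hn.1.1.1.1, hn.1.1.1.2, hn.1.2, hn.2⟩
    have hp4 : ∑ n ∈ (((T.filter (fun n => ¬ (mf n : ℝ) ≤ Real.sqrt N)).filter (fun n => ¬ z₀ ≤ Pf n)).filter
        (fun n => ¬ cfr n ≤ Y)).filter (fun n => ¬ Pf n ≤ L), G (mf n) ≤ C₄ * N * E := by
      refine le_trans (Finset.sum_le_sum_of_subset_of_nonneg ?_ fun n _ _ => hG0 _) hS4
      intro n hn
      simp only [Finset.mem_filter, not_le] at hn ⊢
      exact ⟨hn.1.1.1.1, hn.1.1.1.2, hn.1.1.2, hn.1.2, hn.2⟩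
    have hsum := add_le_add hp0 (add_le_add hp1 (add_le_add hp2 (add_le_add hp3 hp4)))
    refine hsum.trans ?_
    have hN₀12 : 0 ≤ Cg * (N₀ : ℝ) ^ (1 / 12 : ℝ) := by positivity
    nlinarith [mul_le_mul_of_nonneg_left (h34.trans hKpow) hC₀.le, mul_le_mul_of_nonneg_left (h56.trans hKpow) hC₂.le,
      mul_le_mul_of_nonneg_left hKpow hC₃.le, mul_nonneg hN₀12 (mul_nonneg (mul_nonneg hKp0.le hN0.le) hE0.le)]
  · -- small `N`: crude bound `N · Cg N^{1/24} ≤ Cg N₀^{1/12} N^{23/24}`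
    rw [not_le] at hNN
    have hpt : ∀ n ∈ Icc 1 N, G (F.eval (n : ℤ)).toNat ≤ Cg * (N : ℝ) ^ (1 / 24 : ℝ) := fun n hn =>
      hW G hG0 hG1 hGmul hGA N n (by omega) (Finset.mem_Icc.1 hn).2 (hpos n (Finset.mem_Icc.1 hn).1)
    have hNN' : (N : ℝ) ≤ N₀ := by exact_mod_cast hNN.le
    calc ∑ n ∈ Icc 1 N, G (F.eval (n : ℤ)).toNat ≤ ∑ _n ∈ Icc 1 N, Cg * (N : ℝ) ^ (1 / 24 : ℝ) :=
          Finset.sum_le_sum hpt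
      _ = N * (Cg * (N : ℝ) ^ (1 / 24 : ℝ)) := by rw [Finset.sum_const, Nat.card_Icc, nsmul_eq_mul]; push_cast; ring
      _ = Cg * ((N : ℝ) ^ (1 / 12 : ℝ) * (N : ℝ) ^ (23 / 24 : ℝ)) := by
          have hpow : (N : ℝ) * (N : ℝ) ^ (1 / 24 : ℝ) = (N : ℝ) ^ (1 / 12 : ℝ) * (N : ℝ) ^ (23 / 24 : ℝ) := by
            calc (N : ℝ) * (N : ℝ) ^ (1 / 24 : ℝ) = (N : ℝ) ^ (1 : ℝ) * (N : ℝ) ^ (1 / 24 : ℝ) := by rw [Real.rpow_one]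
              _ = (N : ℝ) ^ ((1 : ℝ) + 1 / 24) := by rw [← Real.rpow_add hN0]
              _ = (N : ℝ) ^ ((1 / 12 : ℝ) + 23 / 24) := by norm_num
              _ = (N : ℝ) ^ (1 / 12 : ℝ) * (N : ℝ) ^ (23 / 24 : ℝ) := by rw [Real.rpow_add hN0]
          rw [← hpow]; ring
      _ ≤ Cg * ((N₀ : ℝ) ^ (1 / 12 : ℝ) * (Kp * N * E)) := by gcongr
      _ ≤ ((C₀ + C₂ + C₃ + Cg * (N₀ : ℝ) ^ (1 / 12 : ℝ)) * Kp + C₁ + C₄) * N * E := by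
          have : 0 ≤ (C₀ + C₂ + C₃) * Kp + C₁ + C₄ := by positivity
          nlinarith [mul_nonneg this (mul_nonneg hN0.le hE0.le)]

end Main

/-- **Registered form** (`--supports stmt-Parity-11292`): Nair's theorem (bounded-prime-power class), closed registered form. [folklore] -/
theorem nairTenenbaumLight : ∀ (F : ℤ[X]) (D M : ℕ) (A : ℝ), 1 ≤ F.natDegree → (∀ n : ℕ, 1 ≤ n → 0 < F.eval (n : ℤ)) → (∀ p : ℕ, p.Prime → polyRootCountMod ![F] p ≤ D) → 1 ≤ D → (∀ p : ℕ, p.Prime → polyRootCountMod ![F] p < p) → (∀ p : ℕ, p.Prime → ∀ a : ℕ, 1 ≤ a → polyRootCountMod ![F] (p ^ a) ≤ M) → 1 ≤ M → 1 ≤ A → ∃ C : ℝ, 0 < C ∧ ∀ G : ℕ → ℝ, (∀ n, 0 ≤ G n) → G 1 = 1 → (∀ m n : ℕ, m.Coprime n → G (m * n) = G m * G n) → (∀ p : ℕ, p.Prime → ∀ v : ℕ, 1 ≤ v → G (p ^ v) ≤ A) → ∀ N : ℕ, 2 ≤ N → ∑ n ∈ Icc 1 N, G (F.eval (n : ℤ)).toNat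 ≤ C * N * Real.exp (∑ p ∈ Nat.primesLE N, (G p - 1) * polyRootCountMod ![F] p / p) :=
  fun _F _D _M _A hd hpos hD hD1 hfix hM hM1 hA => nair_sum_le hd hpos hD hD1 hfix hM hM1 hA

end

end Summit.Parity.BatemanHorn.Cruxes.SystemLSDRealSegment.BetaThinnedRootKernel.Nair
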